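import Literature.AlgebraicGeometry.AbelianSchemes.AbelianSchemeConstSubgroupQuotientKernel
import Literature.AlgebraicGeometry.AbelianSchemes.AbelianSchemeConstSubgroupQuotientGroupLaw
import Literature.AlgebraicGeometry.AbelianSchemes.AbelianSchemeConstSubgroupQuotientSmooth
import Literature.AlgebraicGeometry.AbelianSchemes.AbelianSchemeConstSubgroupQuotientEtale
import Literature.AlgebraicGeometry.AbelianSchemes.AbelianSchemeConstSubgroupStableCoverOfQuasiProjective
import Literature.AlgebraicGeometry.AbelianSchemes.AbelianSchemeOverCommOfReduced
import Literature.AlgebraicGeometry.AbelianSchemes.AbelianSchemeOverRestrictPt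
import Literature.AlgebraicGeometry.AbelianSchemes.AbelianSchemeQuotientIsoOfKernelRank
import Literature.AlgebraicGeometry.AbelianSchemes.LevelStructureOfTorsionBasis
import Literature.AlgebraicGeometry.Motives.AbelianVarietyProjectiveChart
import Literature.AlgebraicGeometry.HodgeTheory.QuasiProjectiveOfFinite
import Mathlib.AlgebraicGeometry.AlgClosed.Basic
import HarnessLib

/-!
# The quotient `A⁄K` of an abelian scheme over a FIELD by a finite group of rational points — every RAW binder of
# ★ `quotientBy` discharged at `S = Y = Spec Ω`, and the kernel of `ψ : A → A⁄K` on `Ω`-points in the `AlgPoints` currency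

Layer `Literature/AlgebraicGeometry/AbelianSchemes`, namespace `Literature.AlgebraicGeometry.AbelianSchemes.AbelianSchemeOver`.
THEOREMS ONLY (no definition, no named fact, no instance, no notation, no `sorry`; net Literature debt 0).

Setting: `A : AbelianSchemeOver (Spec Ω)` an abelian scheme over a field `Ω`, `K ≤ A(Spec Ω)` a finite group of sections
(equivalently, by ★ `exists_pointsToSections_monoidHom`, a finite subgroup of the `Ω`-points
`A.toAffine.toAbelianVariety.Points Ω`).  The tree's quotient ★ `quotientBy u K hcov hG hsm hgc` ([MumfordAV1970] §7 Thm. 4)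
carries five RAW hypotheses; at `u = 𝟙 (Spec Ω)` they are all theorems:

* §1 `restrict_specOver_left` — the source of `Ω`-points `specOver Ω Ω` has structure morphism `𝟙`, so `σ(s₀).left = σ.left`;
  freeness of the translation action over a field (`hfree`) is ★ `translation_free_of_field` (`AbelianSchemeQuotientIsoOfKernelRank`
  §2: `Spec Ω′ → Spec Ω` is an epimorphism, ★ `restrict_injective_of_field`), imported, not restated.  [SGA1] V 2.6–2.7.
* §2 **`hcov_of_field`** — every point of `A` lies in a `K`-stable affine open (`hcov`): an abelian variety is projective
  (★ `Motives.AbelianVariety.isProjectiveOver_holds`, [GortzWedhorn2023] 27.174), hence quasi-projective, and ★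
  `translationActionOver_hcov_of_isQuasiProjectiveOver` ([MumfordAV1970] §7 Thm. p. 66, proof); **`exists_grpObj_isMonHom_quotientMk_of_field`**
  (`hG`: ★ `exists_grpObj_isMonHom_quotientMk` + ★ `isCommMonObj_of_field`); **`smooth_quotientOver_hom_of_field`** (`hsm`, `Ω`
  algebraically closed — the residue field of `Spec Ω` is `Ω` (Mathlib `residueFieldIsoBase`), perfect; ★ `smooth_quotientOver_hom`)
  and `smooth_quotientOver_hom_of_field_of_charZero`; `hgc` is ★ `geometricallyConnected_quotientOver_hom` verbatim.
* §3 **`map_quotientMk_eq_one_iff_of_field`** — [MumfordAV1970] §7 Thm. 4 «`K = ker ψ`» ON `Ω`-POINTS IN THE `AlgPoints` CURRENCY: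
  for `P : A.toAffine.toAbelianVariety.Points Ω` (`= A.FibrePoints (Spec (Ω → Ω))` on the nose), `AlgPoints.map ψ P = 1 ↔ ∃ σ ∈ K,
  σ.left = P.left` (★ `comp_quotientMk_eq_one_iff`); and `map_quotientMk_surjective_of_field` (★ `quotientMk_ontoFibres`).
* §4 **`exists_quotient_of_points`** — the RAW-binder-free summary the P6a moduli datum's isogeny roofs read (`RoofΩ` (r1) and the
  `q`-half of (r2), desk F0P6a-plan (g1) Defs v0.4a): for `Ω` algebraically closed and a finite subgroup `K` of `A(Ω)` there are an
  abelian scheme `B` over `Spec Ω` of the same relative dimension and a finite flat surjective homomorphism `q : A → B` whose kernel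
  on `Ω`-points is exactly `K` and which is onto on `Ω`-points.

Cell `hodgecm-mathlib` (D-0151), FLOOR 0 programme P6 «MOD», organ (O-α) α3c ∕ (ρ3) «roof at `Ω`-points, raw binders
discharged» (A-p17 (g25); A-p14 (g32) 18:38:40Z; desk F0P6a-plan (g1) 18:37:47Z).  Count-neutral; HC_CM is proved only modulo
the 2 remaining named inputs (hLiu418, h413) until rung 0 closes; nothing here is about HC.

Mathlib searched (pin): `residueFieldIsoBase`, `IsAlgClosed.of_ringEquiv`, `IsAlgClosed.perfectField`, `Unique (PrimeSpectrum K)`,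
`Spec.map_id`, `Subgroup.mem_map` (used); Mathlib has no quotients of group schemes.  Tree searched: ★ `translation_free_of_field` ∕
`restrict_injective_of_field` ∕ `epi_fieldPoint` (p845031) REUSED by import; no `hcov`∕`hG`∕`hsm` discharge over a field existed
(`rg "hcov_of_field|smooth_quotientOver_hom_of_field"` = ∅).

## References
* [MumfordAV1970] D. Mumford, *Abelian Varieties* (1970), §7 Thm. p. 66 (proof), Thm. 4 (p. 72); §12 Thm. 1 (p. 112).
* [SGA1] A. Grothendieck, *SGA 1*, Exp. V Prop. 2.6, Déf. 2.7.
* [GortzWedhorn2023] U. Görtz, T. Wedhorn, *Algebraic Geometry II* (2023), Prop. 27.174 (p. 880).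
* [Grothendieck1967] A. Grothendieck, *EGA IV₄* (1967), Prop. 17.7.7.
-/

set_option autoImplicit false

noncomputable section

universe u

open CategoryTheory CategoryTheory.Limits AlgebraicGeometry MonoidalCategory CartesianMonoidalCategory
open scoped MonObj

set_option backward.isDefEq.respectTransparency false

namespace Literature.AlgebraicGeometry.AbelianSchemes

namespace AbelianSchemeOver

open Literature.AlgebraicGeometry.RelativeSpec
open Literature.AlgebraicGeometry.Motives (AlgPoints)

variable {Ω : Type u} [Field Ω] (A : AbelianSchemeOver (Spec (.of Ω)))

/-! ## §1 Restriction of a section to the source of `Ω`-points (freeness over a field is ★ `translation_free_of_field`) -/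

section Free

/-- The structure morphism of `specOver Ω Ω` — the source of `Ω`-points — is `𝟙 (Spec Ω)`, so that the underlying morphism of
the restriction `σ(s₀)` of a section to it is `σ.left`. [cite: Hartshorne1977, II Ex. 2.7] -/
theorem restrict_specOver_left (σ : A.Sections) :
    @Eq (Spec (.of Ω) ⟶ A.X.left) (A.restrict (Spec.map (CommRingCat.ofHom (algebraMap Ω Ω))) σ).left σ.left := by
  rw [restrict_left, Algebra.algebraMap_self, CommRingCat.ofHom_id, Spec.map_id]
  exact Category.id_comp _

end Free

/-! ## §2 The RAW binders `hcov`, `hG`, `hsm` of ★ `quotientBy` at `u = 𝟙 (Spec Ω)` -/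

section Binders

/-- `A → Spec Ω → Spec Ω` (`u = 𝟙`) is separated (it is `A → Spec Ω`, proper). [cite: MumfordFogartyKirwan1994, Ch. 6 §1 Definition 6.1 (p. 115)] -/
theorem isSeparated_hom_comp_id : IsSeparated (A.X.hom ≫ 𝟙 (Spec (.of Ω))) := by
  haveI := A.isProper
  rw [Category.comp_id]
  infer_instance

/-- `A → Spec Ω → Spec Ω` (`u = 𝟙`) is locally of finite type. [cite: MumfordFogartyKirwan1994, Ch. 6 §1 Definition 6.1 (p. 115)] -/
theorem locallyOfFiniteType_hom_comp_id : LocallyOfFiniteType (A.X.hom ≫ 𝟙 (Spec (.of Ω))) := by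
  haveI := A.isProper
  rw [Category.comp_id]
  infer_instance

/-- The total space of `A`, as an `Ω`-scheme, is quasi-projective over `Ω`: an abelian variety over a field is projective
(★ `Motives.AbelianVariety.isProjectiveOver_holds`). [cite: GortzWedhorn2023, Prop. 27.174 (p. 880)] -/
theorem isQuasiProjectiveOver_mk_hom_comp_id :
    HodgeTheory.IsQuasiProjectiveOver (Over.mk (A.X.hom ≫ 𝟙 (Spec (.of Ω))) : Motives.SchemeOver Ω) := by
  have hA : Motives.IsProjectiveOver A.X :=
    Motives.AbelianVariety.isProjectiveOver_holds (k := Ω) A.toAffine.toAbelianVariety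
  let h : (Over.mk (A.X.hom ≫ 𝟙 (Spec (.of Ω))) : Motives.SchemeOver Ω) ⟶ A.X :=
    Over.homMk (𝟙 A.X.left) (show 𝟙 A.X.left ≫ A.X.hom = A.X.hom ≫ 𝟙 (Spec (.of Ω)) by
      rw [Category.id_comp, Category.comp_id])
  haveI : IsFinite h.left := by
    change IsFinite (𝟙 A.X.left)
    infer_instance
  exact HodgeTheory.isQuasiProjectiveOver_of_isFinite h (HodgeTheory.IsQuasiProjectiveOver.of_isProjectiveOver hA)

/-- **`hcov` over a field**: every point of the total space of `A` lies in a `K`-stable open, affine over `Spec Ω`, for every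
finite `K ≤ A(Spec Ω)` — `A` is quasi-projective over `Ω` and ★ `translationActionOver_hcov_of_isQuasiProjectiveOver`.
[cite: MumfordAV1970, §7 Thm. p. 66 (proof)] [cite: GortzWedhorn2023, Prop. 27.174 (p. 880)] -/
theorem hcov_of_field (K : Subgroup A.Sections) [Finite K] :
    ∀ x : A.left, ∃ O : (A.translationActionOver (𝟙 (Spec (.of Ω))) K).StableAffineOpens, x ∈ O.1 := by
  haveI := A.isSeparated_hom_comp_id
  exact A.translationActionOver_hcov_of_isQuasiProjectiveOver (𝟙 (Spec (.of Ω))) K A.isQuasiProjectiveOver_mk_hom_comp_id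

variable (K : Subgroup A.Sections) [Finite K] [IsSeparated (A.X.hom ≫ 𝟙 (Spec (.of Ω)))]

/-- **`hG` over a field**: the group law of `A` descends to `A⁄K` making `ψ` a homomorphism — `A` is commutative over a field
(★ `isCommMonObj_of_field`) and the action is free (`translation_free_of_field`); ★ `exists_grpObj_isMonHom_quotientMk`.
[cite: MumfordAV1970, §7 Thm. 4 (p. 72)] -/
theorem exists_grpObj_isMonHom_quotientMk_of_field
    (hcov : ∀ x : A.left, ∃ O : (A.translationActionOver (𝟙 (Spec (.of Ω))) K).StableAffineOpens, x ∈ O.1) :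
    ∃ _ : GrpObj (A.quotientOver (𝟙 (Spec (.of Ω))) K), IsMonHom (A.quotientMk (𝟙 (Spec (.of Ω))) K hcov) := by
  haveI := A.isCommMonObj_of_field
  exact A.exists_grpObj_isMonHom_quotientMk (𝟙 (Spec (.of Ω))) K hcov (A.translation_free_of_field K)

/-- The residue fields of `Spec Ω`, `Ω` algebraically closed, are algebraically closed (each is `Ω`, Mathlib `residueFieldIsoBase`;
the one point of `Spec Ω` is closed). [cite: Grothendieck1967, Prop. 17.7.7] -/
theorem isAlgClosed_residueField_spec [IsAlgClosed Ω] (s : Spec (.of Ω)) : IsAlgClosed ((Spec (.of Ω)).residueField s) := by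
  have hs : IsClosed ({s} : Set (Spec (.of Ω))) := by
    have : ({s} : Set (Spec (.of Ω))) = Set.univ := Set.eq_univ_of_forall fun t => Subsingleton.elim t s
    rw [this]
    exact isClosed_univ
  exact IsAlgClosed.of_ringEquiv Ω _ (residueFieldIsoBase (𝟙 (Spec (.of Ω))) s hs).commRingCatIsoToRingEquiv.symm

/-- **`hsm` over an algebraically closed field (any characteristic)**: `A⁄K → Spec Ω` is smooth — ★ `smooth_quotientOver_hom`
(smoothness descends along the flat surjective `ψ` over a base with perfect residue fields), the residue field of `Spec Ω` being
the perfect field `Ω`. [cite: MumfordAV1970, §7 Thm. 4 (p. 72)] [cite: Grothendieck1967, Prop. 17.7.7] -/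
theorem smooth_quotientOver_hom_of_field [IsAlgClosed Ω]
    (hcov : ∀ x : A.left, ∃ O : (A.translationActionOver (𝟙 (Spec (.of Ω))) K).StableAffineOpens, x ∈ O.1) :
    Smooth (A.quotientOver (𝟙 (Spec (.of Ω))) K).hom := by
  haveI := A.locallyOfFiniteType_hom_comp_id
  exact A.smooth_quotientOver_hom (𝟙 (Spec (.of Ω))) K hcov (A.translation_free_of_field K) fun s => by
    haveI := isAlgClosed_residueField_spec (Ω := Ω) s
    exact IsAlgClosed.perfectField _

/-- **`hsm` over a field of characteristic `0`**: `A⁄K → Spec Ω` is smooth (★ `smooth_quotientOver_hom_of_hom_spec`).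
[cite: MumfordAV1970, §7 Thm. 4 (p. 72)] [cite: Grothendieck1967, Prop. 17.7.7] -/
theorem smooth_quotientOver_hom_of_field_of_charZero [CharZero Ω]
    (hcov : ∀ x : A.left, ∃ O : (A.translationActionOver (𝟙 (Spec (.of Ω))) K).StableAffineOpens, x ∈ O.1) :
    Smooth (A.quotientOver (𝟙 (Spec (.of Ω))) K).hom := by
  haveI := A.locallyOfFiniteType_hom_comp_id
  exact A.smooth_quotientOver_hom_of_hom_spec (𝟙 (Spec (.of Ω))) K hcov (hS := 𝟙 (Spec (.of Ω)))
    (A.translation_free_of_field K)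

end Binders

/-! ## §3 The kernel of `ψ : A → A⁄K` on `Ω`-points, in the `AlgPoints` currency -/

section Kernel

variable (K : Subgroup A.Sections) [Finite K] [IsSeparated (A.X.hom ≫ 𝟙 (Spec (.of Ω)))]
  (hcov : ∀ x : A.left, ∃ O : (A.translationActionOver (𝟙 (Spec (.of Ω))) K).StableAffineOpens, x ∈ O.1)
  [LocallyOfFiniteType (A.X.hom ≫ 𝟙 (Spec (.of Ω)))]
  (hG : ∃ _ : GrpObj (A.quotientOver (𝟙 (Spec (.of Ω))) K), IsMonHom (A.quotientMk (𝟙 (Spec (.of Ω))) K hcov))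
  (hsm : Smooth (A.quotientOver (𝟙 (Spec (.of Ω))) K).hom)
  (hgc : GeometricallyConnected (A.quotientOver (𝟙 (Spec (.of Ω))) K).hom)

/-- **[MumfordAV1970] §7 Thm. 4 «`K = ker ψ`» ON `Ω`-POINTS, `AlgPoints` CURRENCY** (`Ω` algebraically closed): for an `Ω`-point
`P` of `A` (`A.toAffine.toAbelianVariety.Points Ω`, which IS `A.FibrePoints (Spec (Ω → Ω))`), `ψ(P) = 1` in `(A⁄K)(Ω)` iff `P` is
(the point underlying) a section `σ ∈ K` (★ `comp_quotientMk_eq_one_iff` at `s₀ = Spec (Ω → Ω)`, freeness by `translation_free_of_field`).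
[cite: MumfordAV1970, §7 Thm. 4 (p. 72)] -/
theorem map_quotientMk_eq_one_iff_of_field [IsAlgClosed Ω] (P : A.toAffine.toAbelianVariety.Points Ω) :
    letI : GrpObj (A.quotientOver (𝟙 (Spec (.of Ω))) K) := (A.quotientBy (𝟙 (Spec (.of Ω))) K hcov hG hsm hgc).grpObj
    (AlgPoints.map (A.quotientMk (𝟙 (Spec (.of Ω))) K hcov) P :
        (A.quotientBy (𝟙 (Spec (.of Ω))) K hcov hG hsm hgc).toAffine.toAbelianVariety.Points Ω) = 1 ↔
      ∃ σ ∈ K, @Eq (Spec (.of Ω) ⟶ A.X.left) σ.left P.left := by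
  letI : GrpObj (A.quotientOver (𝟙 (Spec (.of Ω))) K) := (A.quotientBy (𝟙 (Spec (.of Ω))) K hcov hG hsm hgc).grpObj
  have h := A.comp_quotientMk_eq_one_iff (𝟙 (Spec (.of Ω))) K hcov hG hsm hgc (A.translation_free_of_field K)
    (Spec.map (CommRingCat.ofHom (algebraMap Ω Ω))) P
  refine (show _ ↔ ∃ σ : K, P = A.restrict (Spec.map (CommRingCat.ofHom (algebraMap Ω Ω))) (σ : A.Sections) from h).trans
    ⟨?_, ?_⟩
  · rintro ⟨σ, hσ⟩
    refine ⟨σ, σ.2, ?_⟩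
    rw [← A.restrict_specOver_left (σ : A.Sections), ← hσ]
  · rintro ⟨σ, hσK, hσ⟩
    refine ⟨⟨σ, hσK⟩, Over.OverMorphism.ext ?_⟩
    exact (hσ.symm.trans (A.restrict_specOver_left σ).symm)

/-- **`K = ker ψ` on `Ω`-points for a finite subgroup `K₀` of `Ω`-POINTS** read through a points-to-sections homomorphism `I`
(★ `exists_pointsToSections_monoidHom`: `(I P).left = P.left`), `K := K₀.map I`: `ψ(P) = 1 ↔ P ∈ K₀` — the shape of the P6a
isogeny roof's clause (r1). [cite: MumfordAV1970, §7 Thm. 4 (p. 72)] -/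
theorem map_quotientMk_eq_one_iff_mem_of_field [IsAlgClosed Ω] (K₀ : Subgroup (A.toAffine.toAbelianVariety.Points Ω))
    (I : A.toAffine.toAbelianVariety.Points Ω →* A.Sections)
    (hI : ∀ P, @Eq (Spec (.of Ω) ⟶ A.X.left) (I P).left P.left) (hK : K = K₀.map I)
    (P : A.toAffine.toAbelianVariety.Points Ω) :
    letI : GrpObj (A.quotientOver (𝟙 (Spec (.of Ω))) K) := (A.quotientBy (𝟙 (Spec (.of Ω))) K hcov hG hsm hgc).grpObj
    (AlgPoints.map (A.quotientMk (𝟙 (Spec (.of Ω))) K hcov) P :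
        (A.quotientBy (𝟙 (Spec (.of Ω))) K hcov hG hsm hgc).toAffine.toAbelianVariety.Points Ω) = 1 ↔ P ∈ K₀ := by
  rw [A.map_quotientMk_eq_one_iff_of_field K hcov hG hsm hgc P]
  subst hK
  constructor
  · rintro ⟨σ, hσK, hσ⟩
    obtain ⟨Q, hQ, rfl⟩ := Subgroup.mem_map.mp hσK
    have hPQ : Q = P := Over.OverMorphism.ext ((hI Q).symm.trans hσ)
    exact hPQ ▸ hQ
  · intro hP
    exact ⟨I P, Subgroup.mem_map_of_mem I hP, hI P⟩

/-- **`ψ` is ONTO on `Ω`-points** (`Ω` algebraically closed), `AlgPoints` currency (★ `quotientMk_ontoFibres` at `s₀ = Spec (Ω → Ω)`).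
[cite: MumfordAV1970, §7 Thm. 4 (p. 72)] -/
theorem map_quotientMk_surjective_of_field [IsAlgClosed Ω]
    (Q : (A.quotientBy (𝟙 (Spec (.of Ω))) K hcov hG hsm hgc).toAffine.toAbelianVariety.Points Ω) :
    ∃ P : A.toAffine.toAbelianVariety.Points Ω,
      (AlgPoints.map (A.quotientMk (𝟙 (Spec (.of Ω))) K hcov) P :
        (A.quotientBy (𝟙 (Spec (.of Ω))) K hcov hG hsm hgc).toAffine.toAbelianVariety.Points Ω) = Q :=
  A.quotientMk_ontoFibres (𝟙 (Spec (.of Ω))) K hcov (Spec.map (CommRingCat.ofHom (algebraMap Ω Ω))) Q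

end Kernel

/-! ## §4 Summary with NO raw binders: the quotient of an abelian scheme over `Ω = Ω̄` by a finite subgroup of `A(Ω)` -/

/-- A finite subgroup of `Ω`-points has a finite image under any points-to-sections homomorphism.
[cite: MumfordFogartyKirwan1994, Ch. 7 §2 Definition 7.1 (p. 129)] -/
theorem finite_map_of_finite (K₀ : Subgroup (A.toAffine.toAbelianVariety.Points Ω)) [Finite K₀]
    (I : A.toAffine.toAbelianVariety.Points Ω →* A.Sections) : Finite (K₀.map I) :=
  Finite.of_surjective (fun x : K₀ => (⟨I x, Subgroup.mem_map_of_mem I x.2⟩ : K₀.map I)) fun ⟨σ, hσ⟩ => by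
    obtain ⟨Q, hQ, rfl⟩ := Subgroup.mem_map.mp hσ
    exact ⟨⟨Q, hQ⟩, rfl⟩

/-- **THE QUOTIENT OF AN ABELIAN SCHEME OVER AN ALGEBRAICALLY CLOSED FIELD BY A FINITE SUBGROUP OF `Ω`-POINTS — NO RAW BINDERS.**
For `A` over `Spec Ω` (`Ω = Ω̄`, any characteristic) and a finite subgroup `K₀ ≤ A(Ω)` there are an abelian scheme `B` over `Spec Ω`
and a homomorphism `q : A → B`, finite, flat, étale and surjective, with (r1) `q(P) = 1 ↔ P ∈ K₀` on `Ω`-points, `q` onto on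
`Ω`-points, and `B` of relative dimension `g` when `A` is: `B := A⁄K` (★ `quotientBy` at `u = 𝟙 (Spec Ω)`, `K := K₀.map I`) with
`hcov`∕`hG`∕`hsm`∕`hgc`∕`hfree` discharged by §§1–2 and ★ `geometricallyConnected_quotientOver_hom`. [cite: MumfordAV1970, §7 Thm. 4 (p. 72)]
[cite: SGA1, Exp. V Cor. 2.4, Prop. 2.6] -/
theorem exists_quotient_of_points [IsAlgClosed Ω] (K₀ : Subgroup (A.toAffine.toAbelianVariety.Points Ω)) [Finite K₀] :
    ∃ (B : AbelianSchemeOver (Spec (.of Ω))) (q : A.X ⟶ B.X) (_ : IsMonHom q),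
      IsFinite q.left ∧ Flat q.left ∧ Etale q.left ∧ Function.Surjective q.left.base ∧
      (∀ P : A.toAffine.toAbelianVariety.Points Ω,
        (AlgPoints.map q P : B.toAffine.toAbelianVariety.Points Ω) = 1 ↔ P ∈ K₀) ∧
      (∀ Q : B.toAffine.toAbelianVariety.Points Ω, ∃ P : A.toAffine.toAbelianVariety.Points Ω, AlgPoints.map q P = Q) ∧
      ∀ g : ℕ, A.IsOfRelDim g → B.IsOfRelDim g := by
  obtain ⟨I, hI⟩ := exists_pointsToSections_monoidHom A.toAffine.toAbelianVariety
  let K : Subgroup A.Sections := K₀.map I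
  haveI : Finite K := A.finite_map_of_finite K₀ I
  haveI := A.isSeparated_hom_comp_id
  haveI := A.locallyOfFiniteType_hom_comp_id
  have hcov := A.hcov_of_field K
  have hG := A.exists_grpObj_isMonHom_quotientMk_of_field K hcov
  have hsm := A.smooth_quotientOver_hom_of_field K hcov
  have hgc := A.geometricallyConnected_quotientOver_hom (𝟙 (Spec (.of Ω))) K hcov
  have hfree := A.translation_free_of_field K
  letI : GrpObj (A.quotientOver (𝟙 (Spec (.of Ω))) K) := (A.quotientBy (𝟙 (Spec (.of Ω))) K hcov hG hsm hgc).grpObj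
  have hψ := A.isMonHom_quotientMk (𝟙 (Spec (.of Ω))) K hcov hG hsm hgc
  refine ⟨A.quotientBy (𝟙 (Spec (.of Ω))) K hcov hG hsm hgc,
    (show A.X ⟶ (A.quotientBy (𝟙 (Spec (.of Ω))) K hcov hG hsm hgc).X from A.quotientMk (𝟙 (Spec (.of Ω))) K hcov), hψ,
    A.isFinite_quotientMk_left (𝟙 (Spec (.of Ω))) K hcov, A.flat_quotientMk_left (𝟙 (Spec (.of Ω))) K hcov hfree,
    A.etale_quotientMk_left (𝟙 (Spec (.of Ω))) K hcov hfree, A.quotientMk_left_surjective (𝟙 (Spec (.of Ω))) K hcov,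
    fun P => A.map_quotientMk_eq_one_iff_mem_of_field K hcov hG hsm hgc K₀ I hI rfl P,
    fun Q => A.map_quotientMk_surjective_of_field K hcov hG hsm hgc Q,
    fun g hA => A.isOfRelDim_quotientBy (𝟙 (Spec (.of Ω))) K hcov hG hsm hgc hfree hA⟩

end AbelianSchemeOver

end Literature.AlgebraicGeometry.AbelianSchemes

end
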